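import Mathlib
import HarnessLib

/-!
# Swell-coloured complete graphs need at least `√n + 1` colours (Ward–Szabó)

S. Jukna, *Extremal Combinatorics — with applications in computer science* (1st ed., Springer 2001)
[Jukna2001], Chapter 4 "The pigeonhole principle", §4.6 "Swell-colored graphs", Theorem 4.9
(Ward–Szabó 1994) and Claim 4.10, with the proof printed there; original: C. Ward, S. Szabó,
*On swell colored complete graphs*, Acta Math. Univ. Comenianae 63 (1994) 303–308 [WardSzabo1994].

An edge colouring of the complete graph `K_n` is *swell* if every triangle carries exactly one or
exactly three colours — never two — and at least two colours are used. We model an edge colouring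
as a symmetric map `c : V → V → γ` (the values `c x x` are irrelevant), "no two-coloured triangle"
as `c x y = c x z → c x y = c y z` for distinct `x, y, z`, and the number `r` of colours used as the
number of values `c x y`, `x ≠ y`.

**Theorem 4.9** (Ward–Szabó 1994). The complete graph on `n` vertices cannot be swell-coloured
with fewer than `√n + 1` colours.

* `ward_szabo_mul` — the printed inequality `r(r - 2) ≥ n - 1` (from `N · r ≥ n - 1` and Claim 4.10,
  `r ≥ N + 2`, where `N` is the largest number of edges of one colour at one vertex).
* `ward_szabo` — the theorem as `n ≤ (r - 1)^2`, i.e. `r ≥ √n + 1`.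
-/

namespace Literature.Combinatorics.SimpleGraph

open Finset

variable {V γ : Type*} [Fintype V] [DecidableEq V] [DecidableEq γ]

/-- **Theorem 4.9** (Ward–Szabó 1994), multiplicative form. Let `c` be a symmetric edge colouring of
the complete graph on the finite vertex set `V`, `|V| = n`, such that no triangle carries exactly two
colours (`c x y = c x z → c x y = c y z` for distinct `x, y, z`) and at least two colours occur. If
`r` is the number of colours used then `n - 1 ≤ r (r - 2)`.

Printed proof: let `N = N(x₀, c₀)` be the maximal number of edges of one colour at one vertex; the
`n - 1` edges at `x₀` fall into `≤ r` classes of size `≤ N`, so `N r ≥ n - 1`; the `c₀`-neighbours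
of `x₀` together with `x₀` form a `c₀`-monochromatic clique `G` on `N + 1` vertices, some vertex
`y ∉ G` sends an edge of another colour to `G`, and then (Claim 4.10) all `N + 1` edges from `y` to
`G` have distinct colours other than `c₀`, whence `r ≥ N + 2`.
[cite: Jukna2001, Ch. 4 §4.6, Theorem 4.9 and Claim 4.10 with their proofs; WardSzabo1994] -/
theorem ward_szabo_mul (c : V → V → γ) (hsymm : ∀ x y, c x y = c y x)
    (hswell : ∀ x y z, x ≠ y → y ≠ z → x ≠ z → c x y = c x z → c x y = c y z)
    (htwo : ∃ x y u v, x ≠ y ∧ u ≠ v ∧ c x y ≠ c u v) :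
    Fintype.card V - 1 ≤
      (((univ : Finset (V × V)).filter fun p => p.1 ≠ p.2).image fun p => c p.1 p.2).card *
        ((((univ : Finset (V × V)).filter fun p => p.1 ≠ p.2).image fun p => c p.1 p.2).card - 2) := by
  set C := ((univ : Finset (V × V)).filter fun p => p.1 ≠ p.2).image fun p => c p.1 p.2 with hC
  have hcC : ∀ x y, x ≠ y → c x y ∈ C := fun x y hxy =>
    mem_image.mpr ⟨(x, y), mem_filter.mpr ⟨mem_univ _, hxy⟩, rfl⟩
  -- the degrees `N(x, col)` and their maximum `N = N(x₀, c₀)`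
  set deg : V × γ → ℕ := fun p => (univ.filter fun y => y ≠ p.1 ∧ c p.1 y = p.2).card with hdeg
  obtain ⟨x, y, u, v, hxy, huv, hne⟩ := htwo
  have hCne : (univ ×ˢ C).Nonempty := ⟨(x, c x y), mem_product.mpr ⟨mem_univ _, hcC x y hxy⟩⟩
  obtain ⟨⟨x₀, c₀⟩, hx₀, hmax⟩ := exists_max_image (univ ×ˢ C) deg hCne
  have hc₀C : c₀ ∈ C := (mem_product.mp hx₀).2
  set N := deg (x₀, c₀) with hN
  have hmax' : ∀ z col, col ∈ C → deg (z, col) ≤ N := fun z col hcol =>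
    hmax (z, col) (mem_product.mpr ⟨mem_univ _, hcol⟩)
  -- (1) `n - 1 ≤ r · N`
  have h1 : Fintype.card V - 1 ≤ C.card * N := by
    have hcard : (univ.filter fun y => y ≠ x₀).card = Fintype.card V - 1 := by
      rw [filter_ne' univ x₀, card_erase_of_mem (mem_univ _), card_univ]
    rw [← hcard, card_eq_sum_card_fiberwise (f := fun y => c x₀ y) (t := C)
      (fun y hy => hcC x₀ y (Ne.symm (mem_filter.mp hy).2))]
    calc ∑ col ∈ C, ((univ.filter fun y => y ≠ x₀).filter fun y => c x₀ y = col).card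
        ≤ ∑ _col ∈ C, N := sum_le_sum fun col hcol => by
            rw [filter_filter]
            exact hmax' x₀ col hcol
      _ = C.card * N := by rw [sum_const, smul_eq_mul]
  -- (2) Claim 4.10: `N + 2 ≤ r`
  have h2 : N + 2 ≤ C.card := by
    -- the `c₀`-monochromatic clique `G = {x₀} ∪ {y : c x₀ y = c₀}`
    set G := insert x₀ (univ.filter fun y => y ≠ x₀ ∧ c x₀ y = c₀) with hG
    have hGcard : G.card = N + 1 := by
      rw [hG, card_insert_of_notMem (by simp)]
    have hx₀G : x₀ ∈ G := mem_insert_self _ _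
    have hmemG : ∀ z, z ≠ x₀ → (z ∈ G ↔ c x₀ z = c₀) := fun z hz => by
      simp [hG, hz]
    have hGmono : ∀ g ∈ G, ∀ g' ∈ G, g ≠ g' → c g g' = c₀ := by
      intro g hg g' hg' hgg'
      by_cases hg1 : g = x₀
      · subst hg1
        exact (hmemG g' (Ne.symm hgg')).mp hg'
      by_cases hg'1 : g' = x₀
      · subst hg'1
        rw [hsymm]
        exact (hmemG g hgg').mp hg
      have hg2 := (hmemG g hg1).mp hg
      have hg'2 := (hmemG g' hg'1).mp hg'
      have := hswell x₀ g g' (Ne.symm hg1) hgg' (Ne.symm hg'1) (by rw [hg2, hg'2])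
      rw [← this, hg2]
    -- some vertex `yy ∉ G` sends an edge of colour `≠ c₀` into `G`
    obtain ⟨yy, g, hyG, hgG, hyg⟩ : ∃ yy g, yy ∉ G ∧ g ∈ G ∧ c yy g ≠ c₀ := by
      by_contra! hall
      have hall' : ∀ a b, a ≠ b → c a b = c₀ := by
        intro a b hab
        by_cases ha : a ∈ G
        · by_cases hb : b ∈ G
          · exact hGmono a ha b hb hab
          · rw [hsymm]
            exact hall b a hb ha
        · by_cases hb : b ∈ G
          · exact hall a b ha hb
          · have hax : c a x₀ = c₀ := hall a x₀ ha hx₀G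
            have hbx : c b x₀ = c₀ := hall b x₀ hb hx₀G
            have hax₀ : a ≠ x₀ := fun h => ha (h ▸ hx₀G)
            have hbx₀ : b ≠ x₀ := fun h => hb (h ▸ hx₀G)
            have := hswell x₀ a b (Ne.symm hax₀) hab (Ne.symm hbx₀)
              (by rw [hsymm x₀ a, hsymm x₀ b, hax, hbx])
            rw [← this, hsymm, hax]
      exact hne (by rw [hall' x y hxy, hall' u v huv])
    have hyx₀ : yy ≠ x₀ := fun h => hyG (h ▸ hx₀G)
    -- all edges from `yy` to `G` avoid the colour `c₀` …
    have havoid : ∀ g' ∈ G, c yy g' ≠ c₀ := by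
      intro g' hg' hc
      have hyx : c x₀ yy = c₀ := by
        by_cases hg'x : g' = x₀
        · rw [hsymm, ← hg'x, hc]
        · have h1 : c g' x₀ = c₀ := hGmono g' hg' x₀ hx₀G hg'x
          have hgy : g' ≠ yy := fun h => hyG (h ▸ hg')
          have := hswell g' yy x₀ hgy hyx₀ hg'x (by rw [hsymm g' yy, hc, h1])
          rw [hsymm x₀ yy, ← this, hsymm g' yy, hc]
      exact hyG ((hmemG yy hyx₀).mpr hyx)
    -- … and are distinctly coloured
    have hinjG : Set.InjOn (fun g' => c yy g') G := by
      intro g₁ hg₁ g₂ hg₂ heq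
      by_contra hne12
      have hy1 : yy ≠ g₁ := fun h => hyG (h ▸ hg₁)
      have hy2 : yy ≠ g₂ := fun h => hyG (h ▸ hg₂)
      have := hswell yy g₁ g₂ hy1 hne12 hy2 heq
      rw [hGmono g₁ hg₁ g₂ hg₂ hne12] at this
      exact havoid g₁ hg₁ this
    have hsub : insert c₀ (G.image fun g' => c yy g') ⊆ C := by
      refine insert_subset hc₀C fun col hcol => ?_
      obtain ⟨g', hg', rfl⟩ := mem_image.mp hcol
      exact hcC yy g' (fun h => hyG (h ▸ hg'))
    calc N + 2 = (insert c₀ (G.image fun g' => c yy g')).card := by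
          rw [card_insert_of_notMem, card_image_of_injOn hinjG, hGcard]
          intro hc₀
          obtain ⟨g', hg', hc⟩ := mem_image.mp hc₀
          exact havoid g' hg' hc
      _ ≤ C.card := card_le_card hsub
  -- (3) combine
  exact h1.trans (Nat.mul_le_mul_left _ (by omega))

/-- **Theorem 4.9** (Ward–Szabó 1994). A complete graph on `n` vertices cannot be swell-coloured
with fewer than `√n + 1` colours: if a symmetric edge colouring of `K_n` with `r` colours has no
two-coloured triangle and uses at least two colours, then `n ≤ (r - 1)^2`.
[cite: Jukna2001, Ch. 4 §4.6, Theorem 4.9; WardSzabo1994] -/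
theorem ward_szabo (c : V → V → γ) (hsymm : ∀ x y, c x y = c y x)
    (hswell : ∀ x y z, x ≠ y → y ≠ z → x ≠ z → c x y = c x z → c x y = c y z)
    (htwo : ∃ x y u v, x ≠ y ∧ u ≠ v ∧ c x y ≠ c u v) :
    Fintype.card V ≤
      ((((univ : Finset (V × V)).filter fun p => p.1 ≠ p.2).image fun p => c p.1 p.2).card - 1) ^ 2 := by
  have h := ward_szabo_mul c hsymm hswell htwo
  set r := (((univ : Finset (V × V)).filter fun p => p.1 ≠ p.2).image fun p => c p.1 p.2).card
  -- at least two colours: `r ≥ 2`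
  obtain ⟨x, y, u, v, hxy, huv, hne⟩ := htwo
  have hr : 2 ≤ r := by
    have hsub : ({c x y, c u v} : Finset γ) ⊆
        ((univ : Finset (V × V)).filter fun p => p.1 ≠ p.2).image fun p => c p.1 p.2 := by
      intro col hcol
      simp only [mem_insert, mem_singleton] at hcol
      rcases hcol with rfl | rfl
      · exact mem_image.mpr ⟨(x, y), mem_filter.mpr ⟨mem_univ _, hxy⟩, rfl⟩
      · exact mem_image.mpr ⟨(u, v), mem_filter.mpr ⟨mem_univ _, huv⟩, rfl⟩
    have := card_le_card hsub
    rwa [card_pair hne] at this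
  clear_value r
  obtain ⟨m, rfl⟩ : ∃ m, r = m + 2 := ⟨r - 2, by omega⟩
  have e1 : (m + 2 - 1) ^ 2 = (m + 2) * (m + 2 - 2) + 1 := by
    rw [show m + 2 - 1 = m + 1 by omega, show m + 2 - 2 = m by omega]
    ring
  rw [e1]
  omega

end Literature.Combinatorics.SimpleGraph
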